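import Mathlib
import Summits.ValiantsHypothesis.ValiantsHypothesis.Theorems.GeneratorObstructionsPowGenDegreeQPDoublingGadgetEasy

/-!
# Route GeneratorObstructions — crux K2 `PowGenDegreeQP` (stmt-ValiantsHypothesis-11655), line
# `trace-side-regimes`: the doubling gadget family inside the window — K2 refuted by the GIT input alone

Companion of `…PowGenDegreeQPDoublingGadget` / `…DoublingGadgetEasy` / `…EvaluationLateness`.
Explicit parameters `t = 2(c₀+2)²`, `k = 2^t`, `c = 4^t` gadget blocks on the FINAL `3c` letters of the
`(5k)²` matrix alphabet, `e = 5k·c − 5k`: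

* `gadget_exponent_bound`, `gadget_parameters` — elementary arithmetic: the `3c` letters fit
  (`3·4^t ≤ 25·4^t`), the cell `(5k, e)` lies in the window with exponent `2`
  (`5k·c ≤ 2^((log₂ 5k + 2)²)`), and `5k · 2^((log₂ 5k + c₀)^c₀) < 2^c` (exponential beats
  quasi-polynomial);
* `not_powGenDegreeQP_of_gadgetGIT` — **if, for every gadget placed on a final segment of interleaved
  letters, some highest-weight vector of NONCONSTANT weight of `ℂ[Δ_{5k} g]` does not vanish at `g`
  (the Kempf–Hilbert–Mumford input: `-χ* = Σ_j 2^j (k e_{B j} + 2k e_{A j} + 2k e_{A' j}) ∈ cone(supp g)`;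
  Kempf 1978 Thm. 3.4/Cor. 3.5 — NOT in the tree), then `PowGenDegreeQP` (K2) is FALSE**, by
  `powGenDegreeQP_gadget_bound` at these parameters.

Honest framing: a conditional refutation BY NAME whose only hypothesis is a classical GIT statement
about an explicit sparse form; the hypothesis is not proved here; no stub, crux or summit is settled;
`VP ≠ VNP` untouched.
-/

namespace Summit.ValiantsHypothesis.ValiantsHypothesis.Theorems.GeneratorObstructions.PowGenDegreeQP

open MvPolynomial
open Literature.NumberTheory.DiophantineGeometry Literature.Computability.AlgebraicComplexity
  Literature.Barriers.ValiantsHypothesis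
open Summit.ValiantsHypothesis.ValiantsHypothesis.Theses.GeneratorObstructions
open Summit.ValiantsHypothesis.ValiantsHypothesis.Theorems.GenInheritance
open Summit.ValiantsHypothesis.ValiantsHypothesis.Theorems.GeneratorObstructions.SliceTransfer

-- `Summit.ValiantsHypothesis.ValiantsHypothesis.…` is the tree's mandated single-conjunct layout.
set_option linter.dupNamespace false

noncomputable section

/-! ## 5. The gadget family inside the window: K2 is refuted by the GIT input alone -/

section Assembly

/-- Exponential beats polynomial, in the explicit form used for the gadget parameters: for every
`c₀`, with `u = c₀ + 2` and `t = 2u²`, `t + 3 + (t + 2 + c₀)^c₀ ≤ 4^t`. [folklore] -/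
theorem gadget_exponent_bound (c₀ t : ℕ) (ht : t = 2 * (c₀ + 2) ^ 2) :
    t + 3 + (t + 2 + c₀) ^ c₀ ≤ 4 ^ t := by
  subst ht
  set u := c₀ + 2 with hu
  have hu2 : 2 ≤ u := by omega
  have hupos : 1 ≤ u := by omega
  -- `(t + 2 + c₀)^c₀ ≤ (4u²)^u ≤ 2^(2u) · u^(2u) ≤ 2^(2u) · 2^(2u²) = 2^(2u² + 2u)`
  have h1 : 2 * u ^ 2 + 2 + c₀ ≤ 4 * u ^ 2 := by nlinarith
  have h2 : (2 * u ^ 2 + 2 + c₀) ^ c₀ ≤ (4 * u ^ 2) ^ u :=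
    (Nat.pow_le_pow_left h1 c₀).trans (Nat.pow_le_pow_right (by positivity) (by omega))
  have h3 : (4 * u ^ 2) ^ u = 2 ^ (2 * u) * u ^ (2 * u) := by
    rw [mul_pow, show (4 : ℕ) = 2 ^ 2 by norm_num, ← pow_mul, ← pow_mul]
  have h4 : u ^ (2 * u) ≤ 2 ^ (2 * u ^ 2) := by
    calc u ^ (2 * u) ≤ (2 ^ u) ^ (2 * u) := Nat.pow_le_pow_left (Nat.lt_two_pow_self).le _
      _ = 2 ^ (2 * u ^ 2) := by rw [← pow_mul]; ring_nf
  have h5 : (2 * u ^ 2 + 2 + c₀) ^ c₀ ≤ 2 ^ (2 * u ^ 2 + 2 * u) := by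
    calc (2 * u ^ 2 + 2 + c₀) ^ c₀ ≤ 2 ^ (2 * u) * u ^ (2 * u) := by rw [← h3]; exact h2
      _ ≤ 2 ^ (2 * u) * 2 ^ (2 * u ^ 2) := Nat.mul_le_mul_left _ h4
      _ = 2 ^ (2 * u ^ 2 + 2 * u) := by rw [← pow_add]; ring_nf
  -- both summands are at most `2^(4u² - 1)`, and `4^t = 2^(4u²)`
  have h6 : 2 * u ^ 2 + 2 * u ≤ 4 * u ^ 2 - 1 := by
    have : 2 * u + 1 ≤ 2 * u ^ 2 := by nlinarith
    omega
  have h7 : (2 * u ^ 2 + 2 + c₀) ^ c₀ ≤ 2 ^ (4 * u ^ 2 - 1) :=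
    h5.trans (Nat.pow_le_pow_right (by norm_num) h6)
  have h8 : 2 * u ^ 2 + 3 ≤ 2 ^ (4 * u ^ 2 - 1) := by
    have h81 : 2 * u ^ 2 + 3 ≤ 4 * u ^ 2 - 1 := by nlinarith
    exact h81.trans (Nat.lt_two_pow_self).le
  have h9 : 4 ^ (2 * u ^ 2) = 2 ^ (4 * u ^ 2 - 1) + 2 ^ (4 * u ^ 2 - 1) := by
    rw [show (4 : ℕ) = 2 ^ 2 by norm_num, ← pow_mul, ← two_mul, ← pow_succ']
    congr 1
    have : 1 ≤ 4 * u ^ 2 := by nlinarith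
    omega
  rw [h9]
  exact Nat.add_le_add h8 h7

/-- `log₂ (5 · 2^t) = t + 2` (as two inequalities). [folklore] -/
theorem log_two_five_mul_two_pow (t : ℕ) :
    t + 2 ≤ Nat.log 2 (5 * 2 ^ t) ∧ Nat.log 2 (5 * 2 ^ t) ≤ t + 2 := by
  constructor
  · have h : 2 ^ (t + 2) ≤ 5 * 2 ^ t := by
      have h4 : 2 ^ (t + 2) = 4 * 2 ^ t := by ring
      rw [h4]; linarith [Nat.one_le_two_pow (n := t)]
    have := Nat.log_mono_right (b := 2) h
    rwa [Nat.log_pow (by norm_num)] at this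
  · have h : 5 * 2 ^ t < 2 ^ (t + 3) := by
      have h8 : 2 ^ (t + 3) = 8 * 2 ^ t := by ring
      rw [h8]; linarith [Nat.one_le_two_pow (n := t)]
    exact Nat.lt_succ_iff.mp (Nat.log_lt_of_lt_pow (b := 2) (by positivity) h)

/-- The gadget parameters at `t = 2(c₀+2)²` (`k = 2^t`, `c = 4^t` blocks, `e = 5k·c - 5k`): the
`3c` gadget letters fit into the `(5k)²` matrix letters; the cell `(5k, e)` lies in the window with
exponent `2`; and `5k · 2^((log₂ 5k + c₀)^c₀) < 2^c`. [folklore] -/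
theorem gadget_parameters_at (c₀ t : ℕ) (ht : t = 2 * (c₀ + 2) ^ 2) :
    1 ≤ t ∧ 3 * 4 ^ t ≤ (5 * 2 ^ t) * (5 * 2 ^ t) ∧
      5 * 2 ^ t * 4 ^ t ≤ 2 ^ ((Nat.log 2 (5 * 2 ^ t) + 2) ^ 2) ∧
      5 * 2 ^ t * 2 ^ ((Nat.log 2 (5 * 2 ^ t) + c₀) ^ c₀) < 2 ^ (4 ^ t) := by
  have ht1 : 1 ≤ t := by
    have : 1 ≤ (c₀ + 2) ^ 2 := Nat.one_le_pow _ _ (by omega)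
    omega
  refine ⟨ht1, ?_, ?_, ?_⟩
  · -- `3 · 4^t ≤ 25 · 4^t`
    have h4 : (4 : ℕ) ^ t = 2 ^ t * 2 ^ t := by
      rw [show (4 : ℕ) = 2 * 2 by norm_num, mul_pow]
    rw [h4]
    nlinarith [Nat.one_le_two_pow (n := t)]
  · -- window: `log₂ (5·2^t) ≥ t + 2`, `5·2^t·4^t ≤ 2^(3t+3) ≤ 2^((t+4)^2)`
    have hlog : t + 2 ≤ Nat.log 2 (5 * 2 ^ t) := (log_two_five_mul_two_pow t).1
    have hexp : 3 * t + 3 ≤ (Nat.log 2 (5 * 2 ^ t) + 2) ^ 2 := by nlinarith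
    have h8 : 5 * 2 ^ t * 4 ^ t ≤ 2 ^ (3 * t + 3) := by
      have h4 : (4 : ℕ) ^ t = 2 ^ t * 2 ^ t := by
        rw [show (4 : ℕ) = 2 * 2 by norm_num, mul_pow]
      have h3 : (2 : ℕ) ^ (3 * t + 3) = 8 * (2 ^ t * (2 ^ t * 2 ^ t)) := by
        rw [show 3 * t + 3 = ((t + t) + t) + 3 by ring, pow_add, pow_add, pow_add]
        norm_num
        ring
      rw [h4, h3]
      nlinarith [Nat.one_le_two_pow (n := t)]
    exact h8.trans (Nat.pow_le_pow_right (by norm_num) hexp)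
  · -- lateness: `log₂ (5·2^t) ≤ t + 2` and `t + 3 + (t+2+c₀)^c₀ ≤ 4^t`
    have hlog : Nat.log 2 (5 * 2 ^ t) ≤ t + 2 := (log_two_five_mul_two_pow t).2
    have hE : t + 3 + (Nat.log 2 (5 * 2 ^ t) + c₀) ^ c₀ ≤ 4 ^ t := by
      have h1 : (Nat.log 2 (5 * 2 ^ t) + c₀) ^ c₀ ≤ (t + 2 + c₀) ^ c₀ :=
        Nat.pow_le_pow_left (Nat.add_le_add_right hlog c₀) _
      exact (Nat.add_le_add_left h1 _).trans (gadget_exponent_bound c₀ t ht)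
    calc 5 * 2 ^ t * 2 ^ ((Nat.log 2 (5 * 2 ^ t) + c₀) ^ c₀)
        < 2 ^ (t + 3) * 2 ^ ((Nat.log 2 (5 * 2 ^ t) + c₀) ^ c₀) := by
          apply Nat.mul_lt_mul_of_pos_right
          · have h8 : 2 ^ (t + 3) = 8 * 2 ^ t := by ring
            rw [h8]; linarith [Nat.one_le_two_pow (n := t)]
          · positivity
      _ = 2 ^ (t + 3 + (Nat.log 2 (5 * 2 ^ t) + c₀) ^ c₀) := by rw [← pow_add]
      _ ≤ 2 ^ (4 ^ t) := Nat.pow_le_pow_right (by norm_num) hE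

/-- **K2 is refuted by the Kempf–Hilbert–Mumford input for the doubling gadget.**  Suppose that for
every `k ≥ 1`, `c ≥ 1` and every placement of the gadget on interleaved letters of the `(5k)²` matrix
alphabet (injective, disjoint, `A j < B (j+1) < A' j`), some highest-weight vector of NONCONSTANT
weight of `ℂ[Δ_{5k} g]` does not vanish at `g = Σ_j x_{B j}^k x_{A j}^{2k} x_{A' j}^{2k}` (by Kempf 1978
Thm. 3.4/Cor. 3.5 + Hilbert–Mumford this holds iff some admissible `χ` has `-χ ∈ cone(supp g)`, and
`-χ* = Σ_j 2^j (k e_{B j} + 2k e_{A j} + 2k e_{A' j})` is such a weight — NOT proved in the tree).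
Then `PowGenDegreeQP` (K2) is false: the gadget with `k = 2^t`, `c = 4^t` blocks on the FINAL `3c`
letters, `t = 2(c₀+2)²`, sits in the window with exponent `2` and beats every bound
`5k · 2^((log₂ 5k + c₀)^c₀)` (`gadget_parameters`, `powGenDegreeQP_gadget_bound`).
[cite: GesmundoIkenmeyerPanova2017, Prop. 5] -/
theorem not_powGenDegreeQP_of_gadgetGIT
    (hGIT : ∀ (k c : ℕ), 1 ≤ k → 0 < c → ∀ (B A A' : Fin c → MatIdx (5 * k)),
      Function.Injective B → Function.Injective A → Function.Injective A' →
      (∀ i j, B i ≠ A j) → (∀ i j, B i ≠ A' j) → (∀ i j, A i ≠ A' j) →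
      (∀ (j : Fin c) (h : j.val + 1 < c), A j < B ⟨j.val + 1, h⟩) →
      (∀ (j : Fin c) (h : j.val + 1 < c), B ⟨j.val + 1, h⟩ < A' j) →
      IsUpperSet (Set.range B ∪ Set.range A ∪ Set.range A') →
      ∃ χ₀ : Weight (MatIdx (5 * k)), (∃ i j, χ₀ i ≠ χ₀ j) ∧
        ∃ x ∈ highestWeightSpace (orbitCoordRep
          (∑ j : Fin c, (X (B j) ^ k * (X (A j) ^ (2 * k) * X (A' j) ^ (2 * k)) :
            MvPolynomial (MatIdx (5 * k)) ℂ)) (5 * k)) χ₀,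
          evalAtPoint (∑ j : Fin c, (X (B j) ^ k * (X (A j) ^ (2 * k) * X (A' j) ^ (2 * k)) :
            MvPolynomial (MatIdx (5 * k)) ℂ)) (5 * k) x ≠ 0) :
    ¬ PowGenDegreeQP := by
  intro hK2
  obtain ⟨c₀, hc₀⟩ := powGenDegreeQP_gadget_bound hK2 2
  obtain ⟨ht, hfit, hwin, hlate⟩ := gadget_parameters_at c₀ (2 * (c₀ + 2) ^ 2) rfl
  set t : ℕ := 2 * (c₀ + 2) ^ 2 with htdef
  -- parameters
  set k : ℕ := 2 ^ t with hk
  set c : ℕ := 4 ^ t with hc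
  have hk1 : 1 ≤ k := Nat.one_le_two_pow
  have hc1 : 0 < c := by positivity
  -- the final segment of `3c` letters of `MatIdx (5k)`
  have hcard : Fintype.card (Fin (3 * c)) ≤ Fintype.card (MatIdx (5 * k)) := by
    rw [Fintype.card_fin, Fintype.card_lex, Fintype.card_prod, Fintype.card_fin]
    exact hfit
  obtain ⟨ι, hι, hup⟩ := exists_strictMono_isUpperSet (σ := Fin (3 * c)) (τ := MatIdx (5 * k)) hcard
  -- positions: `A j = 3j`, `B (j+1) = 3j + 1`, `A' j = 3j + 2`, and `B 0 = 3c - 2`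
  set B : Fin c → MatIdx (5 * k) := fun j =>
    ι ⟨if j.val = 0 then 3 * c - 2 else 3 * j.val - 2, by split_ifs <;> omega⟩ with hB
  set A : Fin c → MatIdx (5 * k) := fun j => ι ⟨3 * j.val, by omega⟩ with hA
  set A' : Fin c → MatIdx (5 * k) := fun j => ι ⟨3 * j.val + 2, by omega⟩ with hA'
  have hιinj := hι.injective
  have hBi : Function.Injective B := by
    intro i j h
    have h' := Fin.mk.inj_iff.mp (hιinj h)
    apply Fin.ext
    split_ifs at h' <;> omega
  have hAi : Function.Injective A := by
    intro i j h
    have h' := Fin.mk.inj_iff.mp (hιinj h)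
    exact Fin.ext (by omega)
  have hA'i : Function.Injective A' := by
    intro i j h
    have h' := Fin.mk.inj_iff.mp (hιinj h)
    exact Fin.ext (by omega)
  have hBA : ∀ i j, B i ≠ A j := by
    intro i j h
    have h' := Fin.mk.inj_iff.mp (hιinj h)
    split_ifs at h' <;> omega
  have hBA' : ∀ i j, B i ≠ A' j := by
    intro i j h
    have h' := Fin.mk.inj_iff.mp (hιinj h)
    split_ifs at h' <;> omega
  have hAA' : ∀ i j, A i ≠ A' j := by
    intro i j h
    have h' := Fin.mk.inj_iff.mp (hιinj h)
    omega
  have hord1 : ∀ (j : Fin c) (h : j.val + 1 < c), A j < B ⟨j.val + 1, h⟩ := by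
    intro j h
    apply hι
    rw [Fin.mk_lt_mk]
    simp; omega
  have hord2 : ∀ (j : Fin c) (h : j.val + 1 < c), B ⟨j.val + 1, h⟩ < A' j := by
    intro j h
    apply hι
    rw [Fin.mk_lt_mk]
    simp; omega
  -- the gadget letters are exactly `range ι`, an upper set
  have hrange : Set.range B ∪ Set.range A ∪ Set.range A' = Set.range ι := by
    ext x
    constructor
    · rintro ((⟨j, rfl⟩ | ⟨j, rfl⟩) | ⟨j, rfl⟩) <;> exact ⟨_, rfl⟩
    · rintro ⟨p, rfl⟩
      -- classify the position `p` mod 3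
      obtain ⟨p, hp⟩ := p
      rcases Nat.lt_or_ge p (3 * c - 2) with hlt | hge
      · obtain ⟨q, r, hr, rfl⟩ : ∃ q r, r < 3 ∧ p = 3 * q + r := ⟨p / 3, p % 3, Nat.mod_lt _ (by norm_num),
          (Nat.div_add_mod p 3).symm⟩
        have hq : q < c := by omega
        interval_cases r
        · exact Or.inl (Or.inr ⟨⟨q, hq⟩, congrArg ι (Fin.ext (by simp))⟩)
        · -- `3q + 1 = B (q+1)`
          have hq1 : q + 1 < c := by omega
          exact Or.inl (Or.inl ⟨⟨q + 1, hq1⟩, congrArg ι (Fin.ext (by simp; omega))⟩)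
        · exact Or.inr ⟨⟨q, hq⟩, congrArg ι (Fin.ext (by simp))⟩
      · -- the last two positions: `3c - 2 = B 0`, `3c - 1 = A' (c-1)`
        rcases Nat.lt_or_ge p (3 * c - 1) with hlt' | hge'
        · have hp' : p = 3 * c - 2 := by omega
          exact Or.inl (Or.inl ⟨⟨0, hc1⟩, congrArg ι (Fin.ext (by simp; omega))⟩)
        · have hp' : p = 3 * c - 1 := by omega
          exact Or.inr ⟨⟨c - 1, by omega⟩, congrArg ι (Fin.ext (by simp; omega))⟩
  have hupper : IsUpperSet (Set.range B ∪ Set.range A ∪ Set.range A') := by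
    rw [hrange]; exact hup
  -- apply the cell bound with `e = 5k·c - 5k`
  have hP : 5 * k ≤ c * (5 * k) := Nat.le_mul_of_pos_left _ hc1
  have hsum : 5 * k + (c * (5 * k) - 5 * k) = 5 * 2 ^ t * 4 ^ t := by
    have h1 : 5 * k + (c * (5 * k) - 5 * k) = c * (5 * k) := by omega
    rw [h1, hk, hc]; ring
  have hb := hc₀ k c (c * (5 * k) - 5 * k) hk1 hc1 (by rw [hsum]; exact hwin)
    (by omega) B A A' hBi hAi hA'i hBA hBA' hAA' hord1 hord2
    (hGIT k c hk1 hc1 B A A' hBi hAi hA'i hBA hBA' hAA' hord1 hord2 hupper)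
  -- contradiction with the lateness inequality
  have hlate' : ((5 * k : ℕ) : ℤ) * 2 ^ ((Nat.log 2 (5 * k) + c₀) ^ c₀) < (2 : ℤ) ^ c := by
    rw [hk, hc]; exact_mod_cast hlate
  exact absurd (hb.trans_lt hlate') (lt_irrefl _)

/-! ### Correction: the GIT input is needed — and available — only for the CANONICAL placement

(Appended, same seat.)  In `not_powGenDegreeQP_of_gadgetGIT` the hypothesis `hGIT` quantifies over
ALL injective, disjoint placements with `A j < B (j+1) < A' j` on an upper set.  That is too much to
ask: the relative position of the remaining letters matters.  If, say, `B 0` is placed AFTER `A 0`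
(as in the placement used inside that proof, `B 0 ↦ 3c - 2`), antitonicity of occurring weights forces
`χ(B 0) = 0` and then `χ = 0` on the whole gadget (`eq_zero_of_relations`), so NO nonzero weight is
admissible, every highest-weight vector of nonconstant weight vanishes at `g`
(`highestWeightSpace_le_ker_evalAtPoint_of_stabilizer`), and that instance of `hGIT` is false — the
theorem is correct but vacuous.  The admissible cone is nonzero exactly for the CANONICAL order
`B 0 < A 0 < B 1 < A' 0 < A 1 < B 2 < A' 1 < … < A (c-1) < A' (c-1)` on the final `3c` letters
(positions `B 0 ↦ 0`, `B j ↦ 3j - 1` (`j ≥ 1`), `A j ↦ 3j + 1`, `A' j ↦ 3j + 3` (`j ≤ c - 2`),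
`A' (c-1) ↦ 3c - 1`), where the admissible dominant weights are the multiples of
`χ* = -Σ_j 2^j (e_{B j} + 2 e_{A j} + 2 e_{A' j})` and `-χ* ∈ cone(supp g)`; for this placement (and
only this one is needed) the Kempf–Hilbert–Mumford criterion gives a nonvanishing nonconstant
semi-invariant.  `not_powGenDegreeQP_of_canonicalGadgetGIT` asks for exactly that. -/

/-- Canonical position of `B j` (`B 0 ↦ 0`, `B j ↦ 3j - 1`) lies below `3c`. [folklore] -/
theorem canonPosB_lt {c : ℕ} (j : Fin c) : (if j.val = 0 then 0 else 3 * j.val - 1) < 3 * c := by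
  have := j.isLt
  split_ifs <;> omega

/-- Canonical position of `A j` (`↦ 3j + 1`) lies below `3c`. [folklore] -/
theorem canonPosA_lt {c : ℕ} (j : Fin c) : 3 * j.val + 1 < 3 * c := by
  have := j.isLt
  omega

/-- Canonical position of `A' j` (`↦ 3j + 3`, last one `↦ 3c - 1`) lies below `3c`. [folklore] -/
theorem canonPosA'_lt {c : ℕ} (j : Fin c) :
    (if j.val = c - 1 then 3 * c - 1 else 3 * j.val + 3) < 3 * c := by
  have := j.isLt
  split_ifs <;> omega

/-- **K2 is refuted by the Kempf–Hilbert–Mumford input for the CANONICAL doubling gadget.**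
Hypothesis: for all `k ≥ 1`, `c ≥ 1` and every strictly monotone `ι : Fin (3c) → MatIdx (5k)` onto
a final segment, some highest-weight vector of NONCONSTANT weight of `ℂ[Δ_{5k} g]` does not vanish at
the canonically placed gadget
`g = Σ_j x_{ι(B j)}^k x_{ι(A j)}^{2k} x_{ι(A' j)}^{2k}`, `B 0 = 0`, `B j = 3j-1`, `A j = 3j+1`,
`A' j = 3j+3` (`j ≤ c-2`), `A' (c-1) = 3c-1` (by Kempf 1978 Thm. 3.4/Cor. 3.5 + Hilbert–Mumford this
holds since `-χ* ∈ cone(supp g)` and no `e_i - e_j` lies in `span(supp g)` — NOT proved in the tree).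
Conclusion: `¬ PowGenDegreeQP`.  Parameters as in `gadget_parameters_at`. [cite: GesmundoIkenmeyerPanova2017, Prop. 5] -/
theorem not_powGenDegreeQP_of_canonicalGadgetGIT
    (hGIT : ∀ (k c : ℕ) (hk : 1 ≤ k) (hc : 0 < c) (ι : Fin (3 * c) → MatIdx (5 * k)),
      StrictMono ι → IsUpperSet (Set.range ι) →
      ∃ χ₀ : Weight (MatIdx (5 * k)), (∃ i j, χ₀ i ≠ χ₀ j) ∧
        ∃ x ∈ highestWeightSpace (orbitCoordRep
          (∑ j : Fin c,
            (X (ι ⟨if j.val = 0 then 0 else 3 * j.val - 1, canonPosB_lt j⟩) ^ k *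
              (X (ι ⟨3 * j.val + 1, canonPosA_lt j⟩) ^ (2 * k) *
                X (ι ⟨if j.val = c - 1 then 3 * c - 1 else 3 * j.val + 3, canonPosA'_lt j⟩) ^ (2 * k)) :
            MvPolynomial (MatIdx (5 * k)) ℂ)) (5 * k)) χ₀,
          evalAtPoint (∑ j : Fin c,
            (X (ι ⟨if j.val = 0 then 0 else 3 * j.val - 1, canonPosB_lt j⟩) ^ k *
              (X (ι ⟨3 * j.val + 1, canonPosA_lt j⟩) ^ (2 * k) *
                X (ι ⟨if j.val = c - 1 then 3 * c - 1 else 3 * j.val + 3, canonPosA'_lt j⟩) ^ (2 * k)) :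
            MvPolynomial (MatIdx (5 * k)) ℂ)) (5 * k) x ≠ 0) :
    ¬ PowGenDegreeQP := by
  intro hK2
  obtain ⟨c₀, hc₀⟩ := powGenDegreeQP_gadget_bound hK2 2
  obtain ⟨ht, hfit, hwin, hlate⟩ := gadget_parameters_at c₀ (2 * (c₀ + 2) ^ 2) rfl
  set t : ℕ := 2 * (c₀ + 2) ^ 2 with htdef
  set k : ℕ := 2 ^ t with hk
  set c : ℕ := 4 ^ t with hc
  have hk1 : 1 ≤ k := Nat.one_le_two_pow
  have hc1 : 0 < c := by positivity
  have hcard : Fintype.card (Fin (3 * c)) ≤ Fintype.card (MatIdx (5 * k)) := by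
    rw [Fintype.card_fin, Fintype.card_lex, Fintype.card_prod, Fintype.card_fin]
    exact hfit
  obtain ⟨ι, hι, hup⟩ := exists_strictMono_isUpperSet (σ := Fin (3 * c)) (τ := MatIdx (5 * k)) hcard
  -- the canonical placement
  set B : Fin c → MatIdx (5 * k) := fun j =>
    ι ⟨if j.val = 0 then 0 else 3 * j.val - 1, canonPosB_lt j⟩ with hB
  set A : Fin c → MatIdx (5 * k) := fun j => ι ⟨3 * j.val + 1, canonPosA_lt j⟩ with hA
  set A' : Fin c → MatIdx (5 * k) := fun j =>
    ι ⟨if j.val = c - 1 then 3 * c - 1 else 3 * j.val + 3, canonPosA'_lt j⟩ with hA'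
  have hιinj := hι.injective
  have hBi : Function.Injective B := by
    intro i j h
    have h' := Fin.mk.inj_iff.mp (hιinj h)
    apply Fin.ext
    split_ifs at h'
    all_goals omega
  have hAi : Function.Injective A := by
    intro i j h
    have h' := Fin.mk.inj_iff.mp (hιinj h)
    exact Fin.ext (by omega)
  have hA'i : Function.Injective A' := by
    intro i j h
    have h' := Fin.mk.inj_iff.mp (hιinj h)
    apply Fin.ext
    split_ifs at h'
    all_goals omega
  have hBA : ∀ i j, B i ≠ A j := by
    intro i j h
    have h' := Fin.mk.inj_iff.mp (hιinj h)
    split_ifs at h'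
    all_goals omega
  have hBA' : ∀ i j, B i ≠ A' j := by
    intro i j h
    have h' := Fin.mk.inj_iff.mp (hιinj h)
    split_ifs at h'
    all_goals omega
  have hAA' : ∀ i j, A i ≠ A' j := by
    intro i j h
    have h' := Fin.mk.inj_iff.mp (hιinj h)
    split_ifs at h'
    all_goals omega
  have hord1 : ∀ (j : Fin c) (h : j.val + 1 < c), A j < B ⟨j.val + 1, h⟩ := by
    intro j h
    apply hι
    rw [Fin.mk_lt_mk]
    simp; omega
  have hord2 : ∀ (j : Fin c) (h : j.val + 1 < c), B ⟨j.val + 1, h⟩ < A' j := by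
    intro j h
    apply hι
    rw [Fin.mk_lt_mk]
    dsimp only
    split_ifs
    all_goals omega
  -- apply the cell bound with `e = 5k·c - 5k`
  have hP : 5 * k ≤ c * (5 * k) := Nat.le_mul_of_pos_left _ hc1
  have hsum : 5 * k + (c * (5 * k) - 5 * k) = 5 * 2 ^ t * 4 ^ t := by
    have h1 : 5 * k + (c * (5 * k) - 5 * k) = c * (5 * k) := by omega
    rw [h1, hk, hc]; ring
  have hb := hc₀ k c (c * (5 * k) - 5 * k) hk1 hc1 (by rw [hsum]; exact hwin)
    (by omega) B A A' hBi hAi hA'i hBA hBA' hAA' hord1 hord2 (hGIT k c hk1 hc1 ι hι hup)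
  have hlate' : ((5 * k : ℕ) : ℤ) * 2 ^ ((Nat.log 2 (5 * k) + c₀) ^ c₀) < (2 : ℤ) ^ c := by
    rw [hk, hc]; exact_mod_cast hlate
  exact absurd (hb.trans_lt hlate') (lt_irrefl _)

end Assembly

end

end Summit.ValiantsHypothesis.ValiantsHypothesis.Theorems.GeneratorObstructions.PowGenDegreeQP
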